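import Mathlib
import HarnessLib
import Summits.HubbardSuperconductivity.HubbardSuperconductivity.Theorems.KLProgrammeKLRegimeVolumeLimitSiteKernelDefs
import Summits.HubbardSuperconductivity.HubbardSuperconductivity.Theorems.KLProgrammeKLRegimeVolumeLimitPeriodization

/-!
# Route `KLProgramme` — crux K3, child «VolumeLimit»: grid samples of FIXED symbols with decaying Fourier coefficients satisfy
# the volume-limit text (the position-space door, exercised end to end)
# (cell gate-hubbard-kl, seat hubbard-kl-r2d-p2 g2; `--supports` the VolumeLimit child)

The simplest class of volume-indexed grid families meeting the VL text `FinalTwoLegVolLimit`-shape: at each Matsubara integer `n`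
and spin `σ` the momentum function on the `L`-torus is the GRID RESTRICTION of one `L`-independent lattice Fourier series,
`S_{L,M}(ω, k⃗, σ) = Σ_{x ∈ ℤ²} e^{-ip_{k⃗}·x} a_{n(ω),σ}(x)` (`latticeFourierTorus L (a n σ) k⃗`), whose coefficients decay
polynomially, `‖a_{n,σ}(x)‖ ≤ C (1 + ‖x‖_∞)^{-K}` UNIFORMLY in `(n, σ)` with `K ≥ latOrder = 4`.  Examples: the free propagator
of any frame at fixed temperature (its symbol `p ↦ 1/(−iω_n + e_K(p))` is real-analytic on the Brillouin torus since `ω_n ≠ 0`),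
the Hartree-dressed propagator, every finite product of such symbols.  For this class the three clauses of the VL text hold
with the symbol itself as the continuum limit: `volLimit_of_latticeFourierTorus`.

The proof is the position-space door run end to end, with no momentum-space argument: the site kernel of `S_{L,M}(ω, ·, σ)`
(`siteKernel`, p471070) is the centred lift of the periodization `Σ_m a(z + Lm)` (discrete Poisson summation), which keeps
the decay `(1 + ‖z‖)^{-K}` with an `L`-INDEPENDENT constant (`hasDecay_centredLift_torusFourierInv_latticeFourierTorus`,
p474044) — clause (a) of the door — and tends sitewise to `a(z)` (`tendsto_centredLift_torusFourierInv_latticeFourierTorus`)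
— clause (b); `volLimit_of_siteKernel` (p470119) then returns the uniform bound, the continuous limit
`Σ∞(n, p, σ) = Σ_z e^{-ip·z} a_{n,σ}(z)` and grid convergence.  Pure composition; nothing is asserted about the model.
-/

noncomputable section

namespace Summit.HubbardSuperconductivity.HubbardSuperconductivity.Theorems.KLRegimeSplit

set_option linter.dupNamespace false -- summit = problem name (single-conjunct summit), D-0017

open Filter Topology Finset Literature.MathematicalPhysics.QuantumLattice Literature.Probability.LatticeModels
open Literature.Analysis.FluidPDE.FourierNS (HasDecay inv_one_add_norm_pow_anti)
open Literature.Analysis.FluidPDE.ScalarFourier (latOrder latMass hasSum_latWeight summable_latWeight latMass_nonneg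
  summable_norm_of_hasDecay)

/-- The site kernel of a grid-restricted lattice Fourier series IS the centred lift of its periodization (definitional). -/
theorem siteKernel_latticeFourierTorus_eq {L : ℕ} [NeZero L] (a : Site 2 → ℂ) (z : Site 2) :
    siteKernel (latticeFourierTorus L a) z =
      if Torus.cRep (Torus.proj L z) = z then torusFourierInv (latticeFourierTorus L a) (Torus.proj L z) else 0 := rfl

/-- **Grid samples of fixed symbols with uniformly decaying Fourier coefficients satisfy the volume-limit text.**  Let
`a : ℤ → Fin 2 → Site 2 → ℂ` have `HasDecay K C (a n σ)` for every Matsubara integer `n` and spin `σ`, with `latOrder (Fin 2) ≤ K`,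
and let `S_{L,M}((ω, k⃗), σ) = latticeFourierTorus L (a (matsubaraInt M ω) σ) k⃗` (the grid restriction of the lattice Fourier
series of `a_{n(ω),σ}`).  Then, for any Matsubara thresholds `Mstar`: `S` is bounded uniformly in `(L, M, ω, k⃗, σ)`, and at every
Matsubara integer converges on the grid (eventually in `L`, trivially in `M`), uniformly on the grid, to the continuous symbol
`Σ∞(n, p, σ) = Σ_z e^{-ip·z} a_{n,σ}(z)`. -/
theorem volLimit_of_latticeFourierTorus {K : ℕ} {C : ℝ} {a : ℤ → Fin 2 → Site 2 → ℂ}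
    (ha : ∀ (n : ℤ) (σ : Fin 2), HasDecay K C (a n σ)) (hK : latOrder (Fin 2) ≤ K) (Mstar : ℕ → ℕ) :
    ∃ sigmaInf : ℤ → (Fin 2 → ℝ) → Fin 2 → ℂ, ∃ B : ℝ, ∃ L₀' : ℕ,
      (∀ (n : ℤ) (σ : Fin 2), Continuous fun p : Fin 2 → ℝ => sigmaInf n p σ) ∧
      (∀ (L : ℕ) [NeZero L], L₀' ≤ L → ∀ (M : ℕ) [NeZero M], Mstar L ≤ M →
        ∀ (k : FreqMomentum L M) (σ : Fin 2), ‖latticeFourierTorus L (a (matsubaraInt M k.1) σ) k.2‖ ≤ B) ∧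
      (∀ (n : ℤ) (σ : Fin 2) (ε : ℝ), 0 < ε → ∃ L₁ : ℕ, ∀ (L : ℕ) [NeZero L], L₁ ≤ L →
        ∃ M₁ : ℕ, ∀ (M : ℕ) [NeZero M], M₁ ≤ M → ∀ ω : MatsubaraIdx M, matsubaraInt M ω = n →
          ∀ k : TorusSite 2 L,
            ‖latticeFourierTorus L (a (matsubaraInt M ω) σ) k - sigmaInf n (latticeMomentum L k) σ‖ ≤ ε) := by
  -- the decay majorant of the centred lifts, uniform in `L ≥ 1` and in `(n, σ)`
  set C' : ℝ := C * (1 + (4 : ℝ) ^ K * latMass (Fin 2)) with hC'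
  have hC0 : 0 ≤ C := (ha 0 0).nonneg
  have hC'0 : 0 ≤ C' := by
    have := latMass_nonneg (d := Fin 2)
    rw [hC']; positivity
  set m : Site 2 → ℝ := fun z => C' * ((1 + ‖z‖) ^ latOrder (Fin 2))⁻¹ with hm
  have hmsum : Summable m := summable_latWeight.mul_left C'
  refine volLimit_of_siteKernel
    (S := fun L M _ _ k σ => latticeFourierTorus L (a (matsubaraInt M k.1) σ) k.2) (Mstar := Mstar)
    (χ := fun z p => Complex.exp (Complex.I * (((-1) * ∑ i, p i * (z i : ℝ) : ℝ) : ℂ)))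
    (continuous_planeWaveChar (-1)) (norm_planeWaveChar_le_one (-1))
    (Spos := fun L M _ _ ω z σ => siteKernel (latticeFourierTorus L (a (matsubaraInt M ω) σ)) z)
    (SposInf := fun n z σ => a n σ z) (m := m) hmsum (L₀ := 1) ?_ ?_ ?_
  · -- representation: Fourier inversion as a site series
    intro L _ _ M _ _ ω k σ
    exact hasSum_siteKernel _ k
  · -- (a) uniform decay majorant
    intro z L _ hL M _ _ ω σ
    have h := hasDecay_centredLift_torusFourierInv_latticeFourierTorus (ha (matsubaraInt M ω) σ) hK (L := L) hL z
    rw [siteKernel_latticeFourierTorus_eq]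
    refine h.trans ?_
    simp only [hm]
    exact mul_le_mul_of_nonneg_left (inv_one_add_norm_pow_anti z hK) hC'0
  · -- (b) sitewise limits (no `M`-dependence beyond the Matsubara integer)
    intro n σ z ε hε
    have hsum : Summable fun x => ‖a n σ x‖ := summable_norm_of_hasDecay hK (ha n σ)
    have ht := tendsto_centredLift_torusFourierInv_latticeFourierTorus hsum z
    rw [Metric.tendsto_atTop] at ht
    obtain ⟨L₁, hL₁⟩ := ht ε hε
    refine ⟨max L₁ 1, fun L _ hL => ⟨0, fun M _ _ ω hω => ?_⟩⟩
    have hL0 : L ≠ 0 := by have := le_of_max_le_right hL; omega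
    have h := hL₁ L (le_of_max_le_left hL)
    rw [dif_neg hL0, dist_eq_norm] at h
    rw [hω, siteKernel_latticeFourierTorus_eq]
    exact h.le

end Summit.HubbardSuperconductivity.HubbardSuperconductivity.Theorems.KLRegimeSplit

end
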